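import Summits.CriticalPhenomena.PercolationContinuityZ3.Theorems.PercNearOneGluingNoHeavyLowerTailSahiCombFiveUpSetRankZ3

/-!
# Zeta / co-zeta duality on the cube: `Σ_{d ⊇ s} f d = Σ_{e ⊆ s} (−1)^{#e} · Z f (eᶜ)`, and its kernel consequences

Support file of the one-cut programme (crux `NoHeavyLowerTail`, stmt-CriticalPhenomena-4575; TRI lane of cell `prim-masterthm`; seat prim-lf-1 gen 26,
memo `FROM-prim-lf-1-gen26-PRINCIPAL-AND-NOGO.md` §3).  Toolkit for the kernel ("support-chase") proofs of the two-copy certificates (`…TriWCertificate*`,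
`…FiveUpSetProof`): besides point support (`zsum_eq_zero_of_not_mem`) and C1/C2′ (`eq_zero_of_zsum_eq_zero_on`) those proofs use the rule (T1) of prim-lf-1
gen 21's type-level engine (`code/gen21/abstract.py`) — "if the zeta sum of `f` vanishes on an up-set `U` then the CO-zeta sum `s ↦ Σ_{d ⊇ s} f d` vanishes
on `refl U`" — and Möbius peeling.  Here they are as tree lemmas, with no hypothesis on the support of `f`:

* `FiveUpSet.cozsum_eq` — the identity `Σ_d f d [s ⊆ d] = Σ_{e ⊆ s} (−1)^{#e} · zsum f eᶜ` (inclusion–exclusion `[s ⊆ d] = Σ_{e ⊆ s ∩ dᶜ} (−1)^{#e}`);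
* `FiveUpSet.zsum_eq_co` — the dual identity `zsum f t = Σ_{e ⊆ tᶜ} (−1)^{#e} · Σ_d f d [e ⊆ d]`;
* **`FiveUpSet.cozsum_eq_zero_of_zsum_eq_zero_on`** — (T1): `zsum f = 0` on an up-set `U` ⟹ `Σ_{d ⊇ s} f d = 0` for every `s` with `sᶜ ∈ U`;
* **`FiveUpSet.zsum_eq_zero_of_cozsum_eq_zero_on`** — the dual: the co-zeta sum vanishes on a down-set `D` ⟹ `zsum f t = 0` for every `t` with `tᶜ ∈ D`;
* `FiveUpSet.eq_zero_of_cozsum_top`, `FiveUpSet.eq_zero_of_zsum_bot` — Möbius peeling: `f s = Σ_{d ⊇ s} f d − Σ_{d ⊋ s} f d` (and dually).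
HONEST LABEL: elementary identities (folklore), recorded for reuse; no new inequality. [this work]
-/

namespace Summit.CriticalPhenomena.PercolationContinuityZ3.Theorems

namespace FiveUpSet

open Finset

variable {α : Type} [DecidableEq α] [Fintype α]

omit [Fintype α] in
/-- Inclusion–exclusion for the co-zeta kernel: `Σ_{e ⊆ s} (−1)^{#e} [d ⊆ eᶜ] = [s ⊆ d]`. [folklore] -/
theorem sum_powerset_neg_one_pow_card_cozeta [Fintype α] (s d : Finset α) :
    ∑ e ∈ s.powerset, (-1 : ℚ) ^ e.card * (if d ⊆ eᶜ then (1 : ℚ) else 0) = if s ⊆ d then 1 else 0 := by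
  have h := sum_powerset_neg_one_pow_card_zeta s dᶜ
  have h1 : ∀ e ∈ s.powerset, (-1 : ℚ) ^ e.card * (if d ⊆ eᶜ then (1 : ℚ) else 0)
      = (-1 : ℚ) ^ e.card * (if e ⊆ dᶜ then (1 : ℚ) else 0) := by
    intro e _
    have hiff : d ⊆ eᶜ ↔ e ⊆ dᶜ := subset_compl_comm
    by_cases hde : d ⊆ eᶜ
    · rw [if_pos hde, if_pos (hiff.1 hde)]
    · rw [if_neg hde, if_neg (fun h' => hde (hiff.2 h'))]
  rw [sum_congr rfl h1, h]
  have h2 : s ∩ dᶜ = ∅ ↔ s ⊆ d := by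
    rw [← sdiff_eq_inter_compl, sdiff_eq_empty_iff_subset]
  by_cases hs : s ⊆ d
  · rw [if_pos hs, if_pos (h2.2 hs)]
  · rw [if_neg hs, if_neg (fun h' => hs (h2.1 h'))]

/-- **Co-zeta through zeta**: `Σ_d f d [s ⊆ d] = Σ_{e ⊆ s} (−1)^{#e} · zsum f eᶜ`. [folklore] -/
theorem cozsum_eq (f : Finset α → ℚ) (s : Finset α) :
    ∑ d, f d * (if s ⊆ d then (1 : ℚ) else 0) = ∑ e ∈ s.powerset, (-1 : ℚ) ^ e.card * zsum f eᶜ := by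
  unfold zsum
  calc ∑ d, f d * (if s ⊆ d then (1 : ℚ) else 0)
      = ∑ d, f d * ∑ e ∈ s.powerset, (-1 : ℚ) ^ e.card * (if d ⊆ eᶜ then (1 : ℚ) else 0) := by
        refine sum_congr rfl fun d _ => ?_
        rw [sum_powerset_neg_one_pow_card_cozeta s d]
    _ = ∑ d, ∑ e ∈ s.powerset, (-1 : ℚ) ^ e.card * (f d * (if d ⊆ eᶜ then (1 : ℚ) else 0)) := by
        refine sum_congr rfl fun d _ => ?_
        rw [mul_sum]
        refine sum_congr rfl fun e _ => ?_
        ring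
    _ = ∑ e ∈ s.powerset, ∑ d, (-1 : ℚ) ^ e.card * (f d * (if d ⊆ eᶜ then (1 : ℚ) else 0)) := sum_comm
    _ = ∑ e ∈ s.powerset, (-1 : ℚ) ^ e.card * ∑ d, f d * (if d ⊆ eᶜ then (1 : ℚ) else 0) := by
        refine sum_congr rfl fun e _ => ?_
        rw [mul_sum]

/-- **Zeta through co-zeta**: `zsum f t = Σ_{e ⊆ tᶜ} (−1)^{#e} · Σ_d f d [e ⊆ d]`. [folklore] -/
theorem zsum_eq_co (f : Finset α → ℚ) (t : Finset α) :
    zsum f t = ∑ e ∈ tᶜ.powerset, (-1 : ℚ) ^ e.card * ∑ d, f d * (if e ⊆ d then (1 : ℚ) else 0) := by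
  unfold zsum
  have key : ∀ d : Finset α, (if d ⊆ t then (1 : ℚ) else 0)
      = ∑ e ∈ tᶜ.powerset, (-1 : ℚ) ^ e.card * (if e ⊆ d then (1 : ℚ) else 0) := by
    intro d
    rw [sum_powerset_neg_one_pow_card_zeta tᶜ d]
    have h2 : tᶜ ∩ d = ∅ ↔ d ⊆ t := by
      rw [inter_comm, ← sdiff_eq_inter_compl, sdiff_eq_empty_iff_subset]
    by_cases hd : d ⊆ t
    · rw [if_pos hd, if_pos (h2.2 hd)]
    · rw [if_neg hd, if_neg (fun h' => hd (h2.1 h'))]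
  calc ∑ d, f d * (if d ⊆ t then (1 : ℚ) else 0)
      = ∑ d, f d * ∑ e ∈ tᶜ.powerset, (-1 : ℚ) ^ e.card * (if e ⊆ d then (1 : ℚ) else 0) := by
        refine sum_congr rfl fun d _ => ?_
        rw [key d]
    _ = ∑ d, ∑ e ∈ tᶜ.powerset, (-1 : ℚ) ^ e.card * (f d * (if e ⊆ d then (1 : ℚ) else 0)) := by
        refine sum_congr rfl fun d _ => ?_
        rw [mul_sum]
        refine sum_congr rfl fun e _ => ?_
        ring
    _ = ∑ e ∈ tᶜ.powerset, ∑ d, (-1 : ℚ) ^ e.card * (f d * (if e ⊆ d then (1 : ℚ) else 0)) := sum_comm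
    _ = ∑ e ∈ tᶜ.powerset, (-1 : ℚ) ^ e.card * ∑ d, f d * (if e ⊆ d then (1 : ℚ) else 0) := by
        refine sum_congr rfl fun e _ => ?_
        rw [mul_sum]

/-- **(T1) of the type-level engine.**  If the zeta sum of `f` vanishes on an up-set `U`, then the co-zeta sum `Σ_{d ⊇ s} f d` vanishes at every `s`
with `sᶜ ∈ U` (all `e ⊆ s` have `eᶜ ⊇ sᶜ`, hence `eᶜ ∈ U`).  No hypothesis on the support of `f`. [this work] -/
theorem cozsum_eq_zero_of_zsum_eq_zero_on {U : Finset (Finset α)} (hU : IsUpperSet (U : Set (Finset α))) (f : Finset α → ℚ)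
    (h : ∀ t ∈ U, zsum f t = 0) {s : Finset α} (hs : sᶜ ∈ U) :
    ∑ d, f d * (if s ⊆ d then (1 : ℚ) else 0) = 0 := by
  rw [cozsum_eq]
  refine sum_eq_zero fun e he => ?_
  rw [mem_powerset] at he
  have heU : eᶜ ∈ U := hU (compl_subset_compl.2 he) hs
  rw [h _ heU, mul_zero]

/-- **Dual (T1).**  If the co-zeta sum `s ↦ Σ_{d ⊇ s} f d` vanishes on a down-set `D`, then `zsum f t = 0` at every `t` with `tᶜ ∈ D`. [this work] -/
theorem zsum_eq_zero_of_cozsum_eq_zero_on {D : Finset (Finset α)} (hD : IsLowerSet (D : Set (Finset α))) (f : Finset α → ℚ)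
    (h : ∀ s ∈ D, ∑ d, f d * (if s ⊆ d then (1 : ℚ) else 0) = 0) {t : Finset α} (ht : tᶜ ∈ D) :
    zsum f t = 0 := by
  rw [zsum_eq_co]
  refine sum_eq_zero fun e he => ?_
  rw [mem_powerset] at he
  have heD : e ∈ D := hD he ht
  rw [h _ heD, mul_zero]

/-- **Möbius peeling from the top.**  `f s = Σ_{d ⊇ s} f d − Σ_{d ⊋ s} f d`: if the co-zeta sum vanishes at `s` and `f` vanishes at every strict superset
of `s`, then `f s = 0`. [folklore] -/
theorem eq_zero_of_cozsum_top (f : Finset α → ℚ) (s : Finset α)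
    (h : ∑ d, f d * (if s ⊆ d then (1 : ℚ) else 0) = 0) (habove : ∀ d, s ⊆ d → d ≠ s → f d = 0) : f s = 0 := by
  have hsplit : ∑ d, f d * (if s ⊆ d then (1 : ℚ) else 0) = f s := by
    rw [← Finset.sum_erase_add _ _ (mem_univ s), if_pos (Subset.refl s), mul_one]
    have hz : ∑ d ∈ univ.erase s, f d * (if s ⊆ d then (1 : ℚ) else 0) = 0 := by
      refine sum_eq_zero fun d hd => ?_
      rw [mem_erase] at hd
      by_cases hsd : s ⊆ d
      · rw [habove d hsd hd.1, zero_mul]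
      · rw [if_neg hsd, mul_zero]
    rw [hz, zero_add]
  rw [← hsplit, h]

/-- **Möbius peeling from the bottom.**  `f t = zsum f t − Σ_{d ⊊ t} f d`: if `zsum f t = 0` and `f` vanishes at every strict subset of `t`, then `f t = 0`. [folklore] -/
theorem eq_zero_of_zsum_bot (f : Finset α → ℚ) (t : Finset α)
    (h : zsum f t = 0) (hbelow : ∀ d, d ⊆ t → d ≠ t → f d = 0) : f t = 0 := by
  have hsplit : zsum f t = f t := by
    unfold zsum
    rw [← Finset.sum_erase_add _ _ (mem_univ t), if_pos (Subset.refl t), mul_one]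
    have hz : ∑ d ∈ univ.erase t, f d * (if d ⊆ t then (1 : ℚ) else 0) = 0 := by
      refine sum_eq_zero fun d hd => ?_
      rw [mem_erase] at hd
      by_cases hdt : d ⊆ t
      · rw [hbelow d hdt hd.1, zero_mul]
      · rw [if_neg hdt, mul_zero]
    rw [hz, zero_add]
  rw [← hsplit, h]

end FiveUpSet

end Summit.CriticalPhenomena.PercolationContinuityZ3.Theorems
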